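import Mathlib
import Summits.MatrixMultiplication.MatrixMultiplication.Theorems.SnSubsetDichotomyPolynomialSlackPermBernstein

/-!
# The cost of hitting a matching of small sets

Crux `Summit.MatrixMultiplication.MatrixMultiplication.Theses.SnSubsetDichotomy.PolynomialSlack`
(item `stmt-MatrixMultiplication-8306`), level-one programme, line transport-split-hull (lead c7, two
dense quotients, matching branch). In the two-dense endgame a matching of `m` scattered heavy cells
forces the dense quotient set `B = T⁻¹U ⊆ S_n` to HIT, at `m` distinct positions `col c`, sets `Q c` of
small total size (`Σ_c |Q c| ≤ m n/8`) with probability at least `1/2` each. This file shows that such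
hitting is exponentially expensive in `m`:

  `m ≤ 330·(1 + log n)·log(6·n!/|B|)`      (`matching_cost_hit`).

Proof: Markov on the hit count `N(b) = #{c : b(col c) ∈ Q c}` (mean `≥ m/2` over `B`, `N ≤ m`) gives a
third of `B` with `N ≥ m/4`; for a uniform permutation `N(π) = Σ_x a(x, π x)` with `a` the `0/1` array
`a(x,y) = [∃ c, col c = x ∧ y ∈ Q c]`, of mean `Σ_c|Q c|/n ≤ m/8` and `Σ a² ≤ m n/8`, so the tree's
Bernstein inequality for permuted sums (`card_permutedSum_tail_le`, deviation `m/8`, range `1`) bounds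
the good third by `2·n!·exp(-m/(320(1 + log n)))`.
-/

namespace Summit.MatrixMultiplication.MatrixMultiplication.Theorems.PolynomialSlack

set_option linter.dupNamespace false

open scoped BigOperators

/-- **Hitting a matching is expensive.** Let `B ⊆ S_n` be non-empty, `col : Fin m → Fin n` injective and
`Q c ⊆ Fin n` with `Σ_c |Q c| ≤ m n/8`. If for every `c` at least `|B|/2` elements `b ∈ B` have `b(col c) ∈ Q c`,
then `m ≤ 330 (1 + log n) log(6·n!/|B|)`: a third of `B` hits `≥ m/4` of the cells, while for a uniform
permutation the count `#{c : b(col c) ∈ Q c} = Σ_x a(x, b x)` has mean `Σ|Q c|/n ≤ m/8`, so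
`card_permutedSum_tail_le` (deviation `m/8`, `Σ a² ≤ m n/8`, range `1`) bounds those permutations by
`2·n!·exp(-m/(320(1+log n)))`. [folklore] -/
theorem matching_cost_hit {n m : ℕ} (hn : 1 ≤ n) (B : Finset (Equiv.Perm (Fin n))) (hB : B.Nonempty)
    (col : Fin m → Fin n) (hcol : Function.Injective col) (Q : Fin m → Finset (Fin n))
    (hQ : ∑ c, ((Q c).card : ℝ) ≤ m * n / 8)
    (hhit : ∀ c, (B.card : ℝ) / 2 ≤ (B.filter fun b => b (col c) ∈ Q c).card) :
    (m : ℝ) ≤ 330 * (1 + Real.log n) * Real.log (6 * n.factorial / B.card) := by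
  -- notation and the basic positivity facts
  set β : ℝ := (B.card : ℝ) with hβ
  have hβ0 : 0 < β := by rw [hβ]; exact_mod_cast hB.card_pos
  have hnR : (1 : ℝ) ≤ n := by exact_mod_cast hn
  have hn0 : (0 : ℝ) < n := by linarith
  set G : ℝ := 1 + Real.log n with hG
  have hG1 : 1 ≤ G := by rw [hG]; linarith [Real.log_nonneg hnR]
  have hG0 : 0 < G := by linarith
  have hβle : β ≤ n.factorial := by
    rw [hβ]
    have : B.card ≤ Fintype.card (Equiv.Perm (Fin n)) := Finset.card_le_univ _
    rw [Fintype.card_perm, Fintype.card_fin] at this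
    exact_mod_cast this
  have hY : 6 ≤ 6 * (n.factorial : ℝ) / β := by
    rw [le_div_iff₀ hβ0]; linarith
  have hY0 : 0 < 6 * (n.factorial : ℝ) / β := by linarith
  set L : ℝ := Real.log (6 * n.factorial / β) with hL
  have hL1 : 1 ≤ L := by
    rw [hL, Real.le_log_iff_exp_le hY0]
    exact le_trans Real.exp_one_lt_d9.le (by linarith)
  have hL0 : 0 < L := by linarith
  have hGL : 0 < G * L := mul_pos hG0 hL0
  -- the case `m = 0`
  rcases Nat.eq_zero_or_pos m with hm | hm
  · have : (m : ℝ) = 0 := by exact_mod_cast hm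
    rw [this, mul_assoc]; exact (mul_pos (by norm_num) hGL).le
  have hmR : (0 : ℝ) < m := by exact_mod_cast hm
  -- the `0/1` array `a x y = [∃ c, col c = x ∧ y ∈ Q c]` (at most one `c`, by injectivity)
  set a : Fin n → Fin n → ℝ := fun x y => ∑ c, if col c = x then (if y ∈ Q c then 1 else 0) else 0
  have ha_apply : ∀ x y, a x y = ∑ c, if col c = x then (if y ∈ Q c then (1 : ℝ) else 0) else 0 :=
    fun x y => rfl
  have ha0 : ∀ x y, 0 ≤ a x y := fun x y =>
    Finset.sum_nonneg fun c _ => by positivity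
  have ha1 : ∀ x y, a x y ≤ 1 := by
    intro x y
    have hcnt : ((Finset.univ.filter fun c : Fin m => col c = x).card : ℝ) ≤ 1 := by
      have : (Finset.univ.filter fun c : Fin m => col c = x).card ≤ 1 :=
        Finset.card_le_one.2 fun c₁ h₁ c₂ h₂ =>
          hcol (((Finset.mem_filter.1 h₁).2).trans ((Finset.mem_filter.1 h₂).2).symm)
      exact_mod_cast this
    calc a x y = ∑ c, (if col c = x then (if y ∈ Q c then (1 : ℝ) else 0) else 0) := rfl
      _ ≤ ∑ c, (if col c = x then (1 : ℝ) else 0) := Finset.sum_le_sum fun c _ => by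
          split_ifs
          exacts [le_rfl, zero_le_one, le_rfl]
      _ = ((Finset.univ.filter fun c : Fin m => col c = x).card : ℝ) := Finset.sum_boole _ _
      _ ≤ 1 := hcnt
  -- the hit count `N π = #{c : π (col c) ∈ Q c}` is the permuted-sum statistic of `a`
  set N : Equiv.Perm (Fin n) → ℝ := fun π => ∑ c, if π (col c) ∈ Q c then (1 : ℝ) else 0
  have hN_apply : ∀ π : Equiv.Perm (Fin n), N π = ∑ c, if π (col c) ∈ Q c then (1 : ℝ) else 0 :=
    fun π => rfl
  have hstat : ∀ π : Equiv.Perm (Fin n), ∑ x, a x (π x) = N π := by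
    intro π
    rw [hN_apply]
    simp only [ha_apply]
    rw [Finset.sum_comm]
    refine Finset.sum_congr rfl fun c _ => ?_
    rw [Fintype.sum_ite_eq]
  have hNle : ∀ π : Equiv.Perm (Fin n), N π ≤ m := fun π => by
    calc N π = ∑ c, (if π (col c) ∈ Q c then (1 : ℝ) else 0) := rfl
      _ ≤ ∑ _c : Fin m, (1 : ℝ) := Finset.sum_le_sum fun c _ => by
          split_ifs
          exacts [le_rfl, zero_le_one]
      _ = m := by simp
  -- total mass `Σ a = Σ_c |Q c|`, hence mean `≤ m/8` and `Σ a² ≤ Σ a ≤ m n/8`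
  have hmass : ∑ x, ∑ y, a x y = ∑ c, ((Q c).card : ℝ) := by
    have h1 : ∀ x, ∑ y, a x y = ∑ c, if col c = x then ((Q c).card : ℝ) else 0 := by
      intro x
      simp only [ha_apply]
      rw [Finset.sum_comm]
      refine Finset.sum_congr rfl fun c _ => ?_
      split_ifs
      · rw [Finset.sum_boole, Finset.filter_mem_eq_inter, Finset.univ_inter]
      · simp
    simp_rw [h1]
    rw [Finset.sum_comm]
    refine Finset.sum_congr rfl fun c _ => ?_
    rw [Fintype.sum_ite_eq]
  have hmean : (∑ x, ∑ y, a x y) / n ≤ m / 8 := by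
    rw [hmass, div_le_iff₀ hn0]; linarith [hQ]
  have hsq : ∑ x, ∑ y, a x y ^ 2 ≤ m * n / 8 := by
    calc ∑ x, ∑ y, a x y ^ 2 ≤ ∑ x, ∑ y, a x y :=
          Finset.sum_le_sum fun x _ => Finset.sum_le_sum fun y _ =>
            pow_le_of_le_one (ha0 x y) (ha1 x y) two_ne_zero
      _ = ∑ c, ((Q c).card : ℝ) := hmass
      _ ≤ m * n / 8 := hQ
  have hS2n : (∑ x, ∑ y, a x y ^ 2) / n ≤ m / 8 := by
    rw [div_le_iff₀ hn0]; linarith [hsq]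
  -- Markov: `Σ_{b ∈ B} N b ≥ m|B|/2` and `N ≤ m`, so a third of `B` has `N ≥ m/4`
  have hsumN : (m : ℝ) * β / 2 ≤ ∑ b ∈ B, N b := by
    have h1 : ∑ b ∈ B, N b = ∑ c, ((B.filter fun b => b (col c) ∈ Q c).card : ℝ) := by
      simp only [hN_apply]
      rw [Finset.sum_comm]
      refine Finset.sum_congr rfl fun c _ => ?_
      rw [Finset.sum_boole]
    rw [h1]
    calc (m : ℝ) * β / 2 = ∑ _c : Fin m, β / 2 := by
          rw [Finset.sum_const, Finset.card_univ, Fintype.card_fin, nsmul_eq_mul]; ring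
      _ ≤ _ := Finset.sum_le_sum fun c _ => hhit c
  have hpart := Finset.card_filter_add_card_filter_not (s := B) (fun b => (m : ℝ) / 4 ≤ N b)
  set Gd := B.filter fun b => (m : ℝ) / 4 ≤ N b
  set Bd := B.filter fun b => ¬ ((m : ℝ) / 4 ≤ N b)
  have hGd3 : β / 3 ≤ (Gd.card : ℝ) := by
    have hsplit : (Gd.card : ℝ) + Bd.card = β := by rw [hβ]; exact_mod_cast hpart
    have h1 : 3 * (m : ℝ) / 4 * Bd.card ≤ ∑ b ∈ Bd, ((m : ℝ) - N b) := by
      calc 3 * (m : ℝ) / 4 * Bd.card = ∑ _b ∈ Bd, 3 * (m : ℝ) / 4 := by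
            rw [Finset.sum_const, nsmul_eq_mul, mul_comm]
        _ ≤ ∑ b ∈ Bd, ((m : ℝ) - N b) := Finset.sum_le_sum fun b hb => by
            have := not_le.1 (Finset.mem_filter.1 hb).2; linarith
    have h2 : ∑ b ∈ Bd, ((m : ℝ) - N b) ≤ ∑ b ∈ B, ((m : ℝ) - N b) :=
      Finset.sum_le_sum_of_subset_of_nonneg (Finset.filter_subset _ _) fun b _ _ => by
        linarith [hNle b]
    have h3 : ∑ b ∈ B, ((m : ℝ) - N b) ≤ m * β / 2 := by
      rw [Finset.sum_sub_distrib, Finset.sum_const, nsmul_eq_mul, ← hβ]; linarith [hsumN]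
    have h4 : (Bd.card : ℝ) ≤ 2 * β / 3 := by
      have h := h1.trans (h2.trans h3)
      have h' : (m : ℝ) * Bd.card ≤ m * (2 * β / 3) := by linarith
      exact le_of_mul_le_mul_left h' hmR
    linarith
  -- the good third lies in the Bernstein tail at deviation `m/8`
  have hsub : Gd ⊆ Finset.univ.filter fun π : Equiv.Perm (Fin n) =>
      (m : ℝ) / 8 ≤ |∑ x, a x (π x) - (∑ x, ∑ y, a x y) / n| := by
    intro b hb
    rw [Finset.mem_filter] at hb ⊢
    refine ⟨Finset.mem_univ _, ?_⟩
    rw [hstat b]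
    have h2 := hb.2
    exact le_trans (by linarith [hmean]) (le_abs_self _)
  have ht : (0 : ℝ) < m / 8 := by positivity
  have hBound := card_permutedSum_tail_le (n := n) 1 a
    (fun x y => abs_le.2 ⟨by linarith [ha0 x y], ha1 x y⟩) ((m : ℝ) / 8) ht
  -- the exponent: `(m/8)²/(32(1+log n)Σa²/n + m) ≥ m/(320(1 + log n))`
  have hD0 : 0 < 32 * (1 + Real.log n) * (∑ x, ∑ y, a x y ^ 2) / n + 8 * 1 * ((m : ℝ) / 8) := by
    have hs0 : 0 ≤ ∑ x, ∑ y, a x y ^ 2 :=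
      Finset.sum_nonneg fun _ _ => Finset.sum_nonneg fun _ _ => sq_nonneg _
    have : 0 ≤ 32 * (1 + Real.log n) * (∑ x, ∑ y, a x y ^ 2) / n := by
      rw [← hG]; exact div_nonneg (mul_nonneg (by linarith) hs0) hn0.le
    linarith
  have hDle :
      32 * (1 + Real.log n) * (∑ x, ∑ y, a x y ^ 2) / n + 8 * 1 * ((m : ℝ) / 8) ≤ 5 * m * G := by
    have h1 : 32 * (1 + Real.log n) * (∑ x, ∑ y, a x y ^ 2) / n =
        32 * G * ((∑ x, ∑ y, a x y ^ 2) / n) := by rw [hG]; ring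
    rw [h1]
    have h2 : 32 * G * ((∑ x, ∑ y, a x y ^ 2) / n) ≤ 32 * G * (m / 8) :=
      mul_le_mul_of_nonneg_left hS2n (by linarith)
    have h3 : (m : ℝ) ≤ m * G := le_mul_of_one_le_right hmR.le hG1
    linarith
  have hexp : (m : ℝ) / (320 * G) ≤ ((m : ℝ) / 8) ^ 2 /
      (32 * (1 + Real.log n) * (∑ x, ∑ y, a x y ^ 2) / n + 8 * 1 * ((m : ℝ) / 8)) := by
    rw [div_le_div_iff₀ (by linarith) hD0]
    calc (m : ℝ) * (32 * (1 + Real.log n) * (∑ x, ∑ y, a x y ^ 2) / n + 8 * 1 * ((m : ℝ) / 8))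
        ≤ m * (5 * m * G) := mul_le_mul_of_nonneg_left hDle hmR.le
      _ = ((m : ℝ) / 8) ^ 2 * (320 * G) := by ring
  have htail : (Gd.card : ℝ) ≤ 2 * n.factorial * Real.exp (-((m : ℝ) / (320 * G))) := by
    calc (Gd.card : ℝ) ≤ ((Finset.univ.filter fun π : Equiv.Perm (Fin n) =>
          (m : ℝ) / 8 ≤ |∑ x, a x (π x) - (∑ x, ∑ y, a x y) / n|).card : ℝ) := by
          exact_mod_cast Finset.card_le_card hsub
      _ ≤ _ := hBound
      _ ≤ 2 * n.factorial * Real.exp (-((m : ℝ) / (320 * G))) :=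
          mul_le_mul_of_nonneg_left (Real.exp_le_exp.2 (neg_le_neg hexp)) (by positivity)
  -- combine: `|B|/3 ≤ 2·n!·exp(-m/(320 G))`, i.e. `exp(m/(320 G)) ≤ 6·n!/|B|`
  have hfin : Real.exp ((m : ℝ) / (320 * G)) ≤ 6 * n.factorial / β := by
    have h := hGd3.trans htail
    rw [Real.exp_neg] at h
    have hE := Real.exp_pos ((m : ℝ) / (320 * G))
    have h2 : β / 3 * Real.exp ((m : ℝ) / (320 * G)) ≤
        2 * n.factorial * (Real.exp ((m : ℝ) / (320 * G)))⁻¹ * Real.exp ((m : ℝ) / (320 * G)) :=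
      mul_le_mul_of_nonneg_right h hE.le
    rw [mul_assoc, inv_mul_cancel₀ hE.ne', mul_one] at h2
    rw [le_div_iff₀ hβ0]
    linarith
  have hlog : (m : ℝ) / (320 * G) ≤ L := by
    rw [hL, Real.le_log_iff_exp_le hY0]; exact hfin
  rw [div_le_iff₀ (by linarith)] at hlog
  linarith [hGL.le]

end Summit.MatrixMultiplication.MatrixMultiplication.Theorems.PolynomialSlack
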